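import Literature.NumberTheory.Sieve.DivisorPowerSums
import HarnessLib

/-!
# Friedlander–Iwaniec, *The polynomial `X² + Y⁴` captures its primes*, §5: divisor and gcd sums for Lemma 5.1

Family `parity`, statement parity.S17. Source: J. Friedlander, H. Iwaniec, Ann. of Math. (2) 148
(1998), 945–1040 [FriedlanderIwaniecAnnals1998], §5, proof of Lemma 5.1 ("Summing over `s₁*`,
`s₂*` then `δ` we conclude that `D_≠(M, N) ≪ M^{1/2} N^{3/2} (log MN)^{2+2^9}`"; the sums
`∑_{d < (MN)^{1/4}} τ(d)^9 d^{-1} ≪ (log MN)^{2^9}`).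

Elementary mean values used by the crude-logarithm version of Lemma 5.1 in this series
(`FriedlanderIwaniecPrimesLemma51`). Everything is PROVED; constants and exponents of `log` are
existential (only powers of `log` matter downstream). With `L = 1 + log x`:

* `exists_sum_tau_pow_le_one`, `exists_sum_tau_pow_div_le_one` — `∑_{n ≤ x} τ(n)^r ≤ C x L^κ` and
  `∑_{n ≤ x} τ(n)^r/n ≤ C L^κ` for all real `x ≥ 1` (the tree's `DivisorPowerSums` for `x ≥ 2`);
* `gcd_le_sum_divisors`, `sum_gcd_le` — `(s, d) ≤ ∑_{e ∣ d, e ∣ s} e` and `∑_{s ≤ S} (s, d) ≤ τ(d) S`;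
* `sum_Icc_filter_dvd_eq` — reindexing the multiples of `e` up to `Y`;
* `exists_sum_tau_pow_gcd_div_le` — `Φ(m) = ∑_{d ≤ Y} τ(d)^r (m, d)/d ≤ C τ(m)^{r+1} L^κ`;
* `exists_weighted_pair_sum_le` — `∑_{1 ≤ s₂ ≤ s₁ ≤ R} ((2R+1)(s₁, s₂)/s₁ + 1) τ(s₁)^r τ(s₂)^r
  ≤ C R² L^κ` (grouping by `g = (s₁, s₂)`, `s_i = g t_i`, the weight becomes `1/t₁`).

## References

* J. Friedlander, H. Iwaniec, Ann. of Math. (2) 148 (1998), 945–1040, proof of Lemma 5.1.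
  [FriedlanderIwaniecAnnals1998]

## Tree

`exists_sum_sigma_zero_pow_le_real`, `exists_sum_sigma_zero_pow_div_le_real`, `sigma_zero_mul_le`,
`sigma_zero_le_of_dvd`, `one_le_sigma_zero` (`DivisorPowerSums`).
-/

open Finset Real
open scoped ArithmeticFunction.sigma

namespace Literature.NumberTheory.Sieve.FriedlanderIwaniecPrimes

/-! ### Divisor power sums from `x ≥ 1` -/

/-- `∑_{n ≤ x} τ(n)^r ≤ C x (1 + log x)^κ` for all real `x ≥ 1`. [folklore] -/
theorem exists_sum_tau_pow_le_one (r : ℕ) :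
    ∃ C : ℝ, 0 < C ∧ ∃ κ : ℕ, ∀ x : ℝ, 1 ≤ x →
      ∑ n ∈ Icc 1 ⌊x⌋₊, (σ 0 n : ℝ) ^ r ≤ C * x * (1 + Real.log x) ^ κ := by
  obtain ⟨C, hC, h⟩ := exists_sum_sigma_zero_pow_le_real r
  refine ⟨C + 1, by positivity, 2 ^ (r + 1), fun x hx => ?_⟩
  have hL : 1 ≤ 1 + Real.log x := by linarith [Real.log_nonneg hx]
  rcases le_or_gt 2 x with hx2 | hx2
  · calc ∑ n ∈ Icc 1 ⌊x⌋₊, (σ 0 n : ℝ) ^ r ≤ C * x * Real.log x ^ (2 ^ (r + 1)) := h x hx2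
      _ ≤ (C + 1) * x * (1 + Real.log x) ^ (2 ^ (r + 1)) := by
          have hl0 := Real.log_nonneg hx
          have h1 : Real.log x ^ (2 ^ (r + 1)) ≤ (1 + Real.log x) ^ (2 ^ (r + 1)) :=
            pow_le_pow_left₀ hl0 (by linarith) _
          have h2 : C * x ≤ (C + 1) * x := by nlinarith
          exact mul_le_mul h2 h1 (pow_nonneg hl0 _) (by nlinarith)
  · have hfl : ⌊x⌋₊ = 1 := by
      rw [Nat.floor_eq_iff (by linarith)]; constructor <;> [simpa using hx; (push_cast; linarith)]
    rw [hfl]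
    simp only [Icc_self, sum_singleton, Nat.cast_one, ArithmeticFunction.sigma_zero_apply,
      Nat.divisors_one, card_singleton, one_pow]
    calc (1 : ℝ) ≤ (C + 1) * 1 * 1 := by linarith
      _ ≤ (C + 1) * x * (1 + Real.log x) ^ (2 ^ (r + 1)) := by
          gcongr
          exact one_le_pow₀ hL

/-- `∑_{n ≤ x} τ(n)^r / n ≤ C (1 + log x)^κ` for all real `x ≥ 1`. [folklore] -/
theorem exists_sum_tau_pow_div_le_one (r : ℕ) :
    ∃ C : ℝ, 0 < C ∧ ∃ κ : ℕ, ∀ x : ℝ, 1 ≤ x →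
      ∑ n ∈ Icc 1 ⌊x⌋₊, (σ 0 n : ℝ) ^ r / n ≤ C * (1 + Real.log x) ^ κ := by
  obtain ⟨C, hC, h⟩ := exists_sum_sigma_zero_pow_div_le_real r
  refine ⟨C + 1, by positivity, 2 ^ (r + 1), fun x hx => ?_⟩
  have hL : 1 ≤ 1 + Real.log x := by linarith [Real.log_nonneg hx]
  rcases le_or_gt 2 x with hx2 | hx2
  · calc ∑ n ∈ Icc 1 ⌊x⌋₊, (σ 0 n : ℝ) ^ r / n ≤ C * Real.log x ^ (2 ^ (r + 1)) := h x hx2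
      _ ≤ (C + 1) * (1 + Real.log x) ^ (2 ^ (r + 1)) := by
          have hl0 := Real.log_nonneg hx
          have h1 : Real.log x ^ (2 ^ (r + 1)) ≤ (1 + Real.log x) ^ (2 ^ (r + 1)) :=
            pow_le_pow_left₀ hl0 (by linarith) _
          exact mul_le_mul (by linarith) h1 (pow_nonneg hl0 _) (by linarith)
  · have hfl : ⌊x⌋₊ = 1 := by
      rw [Nat.floor_eq_iff (by linarith)]; constructor <;> [simpa using hx; (push_cast; linarith)]
    rw [hfl]
    simp only [Icc_self, sum_singleton, Nat.cast_one, ArithmeticFunction.sigma_zero_apply,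
      Nat.divisors_one, card_singleton, one_pow, div_one]
    calc (1 : ℝ) ≤ (C + 1) * 1 := by linarith
      _ ≤ (C + 1) * (1 + Real.log x) ^ (2 ^ (r + 1)) := by
          gcongr
          exact one_le_pow₀ hL

/-- The same sums with a natural-number cutoff `X ≥ 1`: `∑_{n ≤ X} τ(n)^r ≤ C X (1 + log X)^κ`.
[folklore] -/
theorem exists_sum_tau_pow_le_nat (r : ℕ) :
    ∃ C : ℝ, 0 < C ∧ ∃ κ : ℕ, ∀ X : ℕ, 1 ≤ X →
      ∑ n ∈ Icc 1 X, (σ 0 n : ℝ) ^ r ≤ C * X * (1 + Real.log X) ^ κ := by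
  obtain ⟨C, hC, κ, h⟩ := exists_sum_tau_pow_le_one r
  refine ⟨C, hC, κ, fun X hX => ?_⟩
  have := h X (by exact_mod_cast hX)
  rwa [Nat.floor_natCast] at this

/-- `∑_{n ≤ X} τ(n)^r / n ≤ C (1 + log X)^κ` for natural `X ≥ 1`. [folklore] -/
theorem exists_sum_tau_pow_div_le_nat (r : ℕ) :
    ∃ C : ℝ, 0 < C ∧ ∃ κ : ℕ, ∀ X : ℕ, 1 ≤ X →
      ∑ n ∈ Icc 1 X, (σ 0 n : ℝ) ^ r / n ≤ C * (1 + Real.log X) ^ κ := by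
  obtain ⟨C, hC, κ, h⟩ := exists_sum_tau_pow_div_le_one r
  refine ⟨C, hC, κ, fun X hX => ?_⟩
  have := h X (by exact_mod_cast hX)
  rwa [Nat.floor_natCast] at this

/-! ### gcd sums -/

/-- `(s, d) ≤ ∑_{e ∣ d, e ∣ s} e` for `d ≠ 0` (the gcd is one of the summands). [folklore] -/
theorem gcd_le_sum_divisors {d : ℕ} (hd : d ≠ 0) (s : ℕ) :
    (Nat.gcd s d : ℝ) ≤ ∑ e ∈ d.divisors.filter (· ∣ s), (e : ℝ) := by
  have hmem : Nat.gcd s d ∈ d.divisors.filter (· ∣ s) :=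
    mem_filter.mpr ⟨Nat.mem_divisors.mpr ⟨Nat.gcd_dvd_right s d, hd⟩, Nat.gcd_dvd_left s d⟩
  exact single_le_sum (f := fun e : ℕ => (e : ℝ)) (fun _ _ => Nat.cast_nonneg _) hmem

/-- `∑_{1 ≤ s ≤ S} (s, d) ≤ τ(d) S` for `d ≠ 0`. [folklore] -/
theorem sum_gcd_le {d : ℕ} (hd : d ≠ 0) (S : ℕ) :
    ∑ s ∈ Icc 1 S, (Nat.gcd s d : ℝ) ≤ (σ 0 d : ℝ) * S := by
  calc ∑ s ∈ Icc 1 S, (Nat.gcd s d : ℝ)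
      ≤ ∑ s ∈ Icc 1 S, ∑ e ∈ d.divisors.filter (· ∣ s), (e : ℝ) :=
        sum_le_sum fun s _ => gcd_le_sum_divisors hd s
    _ = ∑ e ∈ d.divisors, ∑ s ∈ (Icc 1 S).filter (e ∣ ·), (e : ℝ) := by
        rw [sum_comm' (t' := d.divisors) (s' := fun e => (Icc 1 S).filter (e ∣ ·))]
        intro e s
        simp only [mem_filter]
        tauto
    _ = ∑ e ∈ d.divisors, (e : ℝ) * #((Icc 1 S).filter (e ∣ ·)) := by
        refine sum_congr rfl fun e _ => ?_
        rw [sum_const, nsmul_eq_mul, mul_comm]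
    _ ≤ ∑ e ∈ d.divisors, (S : ℝ) := by
        refine sum_le_sum fun e he => ?_
        have he0 : 0 < e := Nat.pos_of_mem_divisors he
        have hcard : #((Icc 1 S).filter (e ∣ ·)) = S / e := by
          rw [show Icc 1 S = Ioc 0 S from Finset.Icc_add_one_left_eq_Ioc 0 S]
          exact Nat.Ioc_filter_dvd_card_eq_div S e
        calc (e : ℝ) * #((Icc 1 S).filter (e ∣ ·)) = ((e * (S / e) : ℕ) : ℝ) := by
              rw [hcard]; push_cast; ring
          _ ≤ S := by exact_mod_cast Nat.mul_div_le S e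
    _ = (σ 0 d : ℝ) * S := by
        rw [sum_const, nsmul_eq_mul, ArithmeticFunction.sigma_zero_apply]

/-- Reindexing the multiples of `e ≥ 1` in `[1, Y]`: `d = e d'`, `1 ≤ d' ≤ Y/e`. [folklore] -/
theorem sum_Icc_filter_dvd_eq {e : ℕ} (he : 0 < e) (Y : ℕ) (f : ℕ → ℝ) :
    ∑ d ∈ (Icc 1 Y).filter (e ∣ ·), f d = ∑ d' ∈ Icc 1 (Y / e), f (e * d') := by
  have himg : (Icc 1 Y).filter (e ∣ ·) = (Icc 1 (Y / e)).image (e * ·) := by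
    ext d
    simp only [mem_filter, mem_Icc, mem_image]
    constructor
    · rintro ⟨⟨h1, h2⟩, ⟨d', rfl⟩⟩
      refine ⟨d', ⟨?_, ?_⟩, rfl⟩
      · rcases Nat.eq_zero_or_pos d' with h0 | h0
        · rw [h0, mul_zero] at h1; omega
        · exact h0
      · exact (Nat.le_div_iff_mul_le he).mpr (by rwa [mul_comm] at h2)
    · rintro ⟨d', ⟨h1, h2⟩, rfl⟩
      refine ⟨⟨?_, ?_⟩, dvd_mul_right e d'⟩
      · exact Nat.one_le_iff_ne_zero.mpr (Nat.mul_ne_zero he.ne' (by omega))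
      · calc e * d' ≤ e * (Y / e) := Nat.mul_le_mul_left e h2
          _ ≤ Y := Nat.mul_div_le Y e
  rw [himg, sum_image]
  intro a _ b _ hab
  exact Nat.eq_of_mul_eq_mul_left he hab

/-- **`Φ(m) = ∑_{d ≤ Y} τ(d)^r (m, d)/d ≤ C τ(m)^{r+1} (1 + log Y)^κ`** for `m ≠ 0`, `Y ≥ 1`:
`(m, d) ≤ ∑_{e ∣ m, e ∣ d} e`, then `d = e d'` and `τ(e d') ≤ τ(e) τ(d')`. [folklore] -/
theorem exists_sum_tau_pow_gcd_div_le (r : ℕ) :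
    ∃ C : ℝ, 0 < C ∧ ∃ κ : ℕ, ∀ m : ℕ, m ≠ 0 → ∀ Y : ℕ, 1 ≤ Y →
      ∑ d ∈ Icc 1 Y, (σ 0 d : ℝ) ^ r * Nat.gcd m d / d ≤
        C * (σ 0 m : ℝ) ^ (r + 1) * (1 + Real.log Y) ^ κ := by
  obtain ⟨C, hC, κ, h⟩ := exists_sum_tau_pow_div_le_nat r
  refine ⟨C, hC, κ, fun m hm Y hY => ?_⟩
  have hL : 1 ≤ 1 + Real.log Y := by
    have : (1 : ℝ) ≤ Y := by exact_mod_cast hY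
    linarith [Real.log_nonneg this]
  -- the inner sums are bounded uniformly in `e`
  have hinner : ∀ e : ℕ, 0 < e →
      ∑ d' ∈ Icc 1 (Y / e), (σ 0 d' : ℝ) ^ r / d' ≤ C * (1 + Real.log Y) ^ κ := by
    intro e he
    rcases Nat.eq_zero_or_pos (Y / e) with h0 | h0
    · rw [h0]; simp only [Icc_eq_empty_of_lt zero_lt_one, sum_empty]; positivity
    · calc ∑ d' ∈ Icc 1 (Y / e), (σ 0 d' : ℝ) ^ r / d' ≤ C * (1 + Real.log (Y / e : ℕ)) ^ κ := h _ h0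
        _ ≤ C * (1 + Real.log Y) ^ κ := by
            have h1 : (1 : ℝ) ≤ (Y / e : ℕ) := by exact_mod_cast h0
            have h2 : ((Y / e : ℕ) : ℝ) ≤ Y := by exact_mod_cast Nat.div_le_self Y e
            have h3 : Real.log (Y / e : ℕ) ≤ Real.log Y := Real.log_le_log (by linarith) h2
            have h4 : 0 ≤ 1 + Real.log (Y / e : ℕ) := by linarith [Real.log_nonneg h1]
            exact mul_le_mul_of_nonneg_left (pow_le_pow_left₀ h4 (by linarith) κ) hC.le
  calc ∑ d ∈ Icc 1 Y, (σ 0 d : ℝ) ^ r * Nat.gcd m d / d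
      ≤ ∑ d ∈ Icc 1 Y, ∑ e ∈ m.divisors.filter (· ∣ d), (σ 0 d : ℝ) ^ r / d * e := by
        refine sum_le_sum fun d hd => ?_
        rw [← mul_sum, Nat.gcd_comm]
        calc (σ 0 d : ℝ) ^ r * (Nat.gcd d m) / d = (σ 0 d : ℝ) ^ r / d * Nat.gcd d m := by ring
          _ ≤ (σ 0 d : ℝ) ^ r / d * ∑ e ∈ m.divisors.filter (· ∣ d), (e : ℝ) :=
              mul_le_mul_of_nonneg_left (gcd_le_sum_divisors hm d) (by positivity)
    _ = ∑ e ∈ m.divisors, ∑ d ∈ (Icc 1 Y).filter (e ∣ ·), (σ 0 d : ℝ) ^ r / d * e := by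
        rw [sum_comm' (t' := m.divisors) (s' := fun e => (Icc 1 Y).filter (e ∣ ·))]
        intro d e
        simp only [mem_filter]
        tauto
    _ = ∑ e ∈ m.divisors, ∑ d' ∈ Icc 1 (Y / e), (σ 0 (e * d') : ℝ) ^ r / (e * d' : ℕ) * e := by
        refine sum_congr rfl fun e he => ?_
        exact sum_Icc_filter_dvd_eq (Nat.pos_of_mem_divisors he) Y
          (fun d => (σ 0 d : ℝ) ^ r / d * e)
    _ ≤ ∑ e ∈ m.divisors, ∑ d' ∈ Icc 1 (Y / e), (σ 0 e : ℝ) ^ r * ((σ 0 d' : ℝ) ^ r / d') := by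
        refine sum_le_sum fun e he => sum_le_sum fun d' hd' => ?_
        have he0 : (0 : ℝ) < e := by exact_mod_cast Nat.pos_of_mem_divisors he
        have hd0 : (0 : ℝ) < d' := by exact_mod_cast (mem_Icc.mp hd').1
        have hmul : (σ 0 (e * d') : ℝ) ≤ (σ 0 e : ℝ) * σ 0 d' := by
          exact_mod_cast sigma_zero_mul_le e d'
        calc (σ 0 (e * d') : ℝ) ^ r / (e * d' : ℕ) * e
            = (σ 0 (e * d') : ℝ) ^ r / d' := by
              have hne : (e : ℝ) ≠ 0 := he0.ne'
              push_cast
              field_simp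
          _ ≤ ((σ 0 e : ℝ) * σ 0 d') ^ r / d' :=
              div_le_div_of_nonneg_right (pow_le_pow_left₀ (by positivity) hmul r) hd0.le
          _ = (σ 0 e : ℝ) ^ r * ((σ 0 d' : ℝ) ^ r / d') := by rw [mul_pow]; ring
    _ = ∑ e ∈ m.divisors, (σ 0 e : ℝ) ^ r * ∑ d' ∈ Icc 1 (Y / e), (σ 0 d' : ℝ) ^ r / d' := by
        refine sum_congr rfl fun e _ => ?_; rw [mul_sum]
    _ ≤ ∑ e ∈ m.divisors, (σ 0 m : ℝ) ^ r * (C * (1 + Real.log Y) ^ κ) := by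
        refine sum_le_sum fun e he => ?_
        have he0 := Nat.pos_of_mem_divisors he
        have hem : (σ 0 e : ℝ) ≤ σ 0 m := by
          exact_mod_cast sigma_zero_le_of_dvd hm (Nat.dvd_of_mem_divisors he)
        have hs0 : 0 ≤ ∑ d' ∈ Icc 1 (Y / e), (σ 0 d' : ℝ) ^ r / d' :=
          sum_nonneg fun _ _ => by positivity
        calc (σ 0 e : ℝ) ^ r * ∑ d' ∈ Icc 1 (Y / e), (σ 0 d' : ℝ) ^ r / d'
            ≤ (σ 0 m : ℝ) ^ r * ∑ d' ∈ Icc 1 (Y / e), (σ 0 d' : ℝ) ^ r / d' :=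
              mul_le_mul_of_nonneg_right (pow_le_pow_left₀ (by positivity) hem r) hs0
          _ ≤ (σ 0 m : ℝ) ^ r * (C * (1 + Real.log Y) ^ κ) :=
              mul_le_mul_of_nonneg_left (hinner e he0) (by positivity)
    _ = C * (σ 0 m : ℝ) ^ (r + 1) * (1 + Real.log Y) ^ κ := by
        rw [sum_const, nsmul_eq_mul, ← ArithmeticFunction.sigma_zero_apply, pow_succ]; ring

/-- **The weighted pair sum of Lemma 5.1**: for `R ≥ 1`,
`∑_{1 ≤ s₂ ≤ s₁ ≤ R} ((2R+1)(s₁, s₂)/s₁ + 1) τ(s₁)^r τ(s₂)^r ≤ C R² (1 + log R)^κ`. Grouping by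
`g = (s₁, s₂)`, `s_i = g t_i`: the weight `(s₁, s₂)/s₁` is `1/t₁`, `τ(g t_i) ≤ τ(g) τ(t_i)`, and
`∑_{t₂ ≤ t₁} τ(t₂)^r ≤ C t₁ L^κ` cancels `1/t₁`. [cite: FriedlanderIwaniecAnnals1998, proof of Lemma 5.1] -/
theorem exists_weighted_pair_sum_le (r : ℕ) :
    ∃ C : ℝ, 0 < C ∧ ∃ κ : ℕ, ∀ R : ℕ, 1 ≤ R →
      ∑ s₁ ∈ Icc 1 R, ∑ s₂ ∈ Icc 1 s₁,
        ((2 * R + 1) * (Nat.gcd s₁ s₂ : ℝ) / s₁ + 1) * (σ 0 s₁ : ℝ) ^ r * (σ 0 s₂ : ℝ) ^ r ≤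
        C * (R : ℝ) ^ 2 * (1 + Real.log R) ^ κ := by
  obtain ⟨C₁, hC₁, κ₁, h₁⟩ := exists_sum_tau_pow_le_nat r
  obtain ⟨C₂, hC₂, κ₂, h₂⟩ := exists_sum_tau_pow_div_le_nat (2 * r)
  refine ⟨3 * C₁ ^ 2 * C₂ + C₁ ^ 2, by positivity, 2 * κ₁ + κ₂, fun R hR => ?_⟩
  set L := 1 + Real.log R with hLdef
  have hR1 : (1 : ℝ) ≤ R := by exact_mod_cast hR
  have hL : 1 ≤ L := by rw [hLdef]; linarith [Real.log_nonneg hR1]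
  -- monotonicity of the basic sums in the cutoff
  have hsum_le : ∀ X : ℕ, 1 ≤ X → X ≤ R → ∑ n ∈ Icc 1 X, (σ 0 n : ℝ) ^ r ≤ C₁ * X * L ^ κ₁ := by
    intro X hX hXR
    have hX1 : (1 : ℝ) ≤ X := by exact_mod_cast hX
    calc ∑ n ∈ Icc 1 X, (σ 0 n : ℝ) ^ r ≤ C₁ * X * (1 + Real.log X) ^ κ₁ := h₁ X hX
      _ ≤ C₁ * X * L ^ κ₁ := by
          have : Real.log X ≤ Real.log R := Real.log_le_log (by linarith) (by exact_mod_cast hXR)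
          have h0 : 0 ≤ 1 + Real.log X := by linarith [Real.log_nonneg hX1]
          exact mul_le_mul_of_nonneg_left (pow_le_pow_left₀ h0 (by rw [hLdef]; linarith) _)
            (by positivity)
  -- pass to the sigma set
  set S := (Icc 1 R).sigma fun s₁ => Icc 1 s₁ with hS
  set A : (Σ _ : ℕ, ℕ) → ℝ := fun x =>
    (Nat.gcd x.1 x.2 : ℝ) / x.1 * (σ 0 x.1 : ℝ) ^ r * (σ 0 x.2 : ℝ) ^ r with hA
  set B : (Σ _ : ℕ, ℕ) → ℝ := fun x => (σ 0 x.1 : ℝ) ^ r * (σ 0 x.2 : ℝ) ^ r with hB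
  have hLHS : ∑ s₁ ∈ Icc 1 R, ∑ s₂ ∈ Icc 1 s₁,
      ((2 * R + 1) * (Nat.gcd s₁ s₂ : ℝ) / s₁ + 1) * (σ 0 s₁ : ℝ) ^ r * (σ 0 s₂ : ℝ) ^ r =
      (2 * R + 1) * ∑ x ∈ S, A x + ∑ x ∈ S, B x := by
    rw [mul_sum, ← sum_add_distrib, hS, sum_sigma]
    refine sum_congr rfl fun s₁ _ => sum_congr rfl fun s₂ _ => ?_
    simp only [hA, hB]
    ring
  -- the unweighted part
  have hW₂ : ∑ x ∈ S, B x ≤ (C₁ * R * L ^ κ₁) ^ 2 := by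
    rw [hS, sum_sigma]
    simp only [hB]
    calc ∑ s₁ ∈ Icc 1 R, ∑ s₂ ∈ Icc 1 s₁, (σ 0 s₁ : ℝ) ^ r * (σ 0 s₂ : ℝ) ^ r
        ≤ ∑ s₁ ∈ Icc 1 R, ∑ s₂ ∈ Icc 1 R, (σ 0 s₁ : ℝ) ^ r * (σ 0 s₂ : ℝ) ^ r := by
          refine sum_le_sum fun s₁ hs₁ => sum_le_sum_of_subset_of_nonneg
            (Icc_subset_Icc_right (mem_Icc.mp hs₁).2) fun _ _ _ => by positivity
      _ = (∑ s ∈ Icc 1 R, (σ 0 s : ℝ) ^ r) ^ 2 := by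
          rw [sq, sum_mul_sum]
      _ ≤ (C₁ * R * L ^ κ₁) ^ 2 :=
          pow_le_pow_left₀ (sum_nonneg fun _ _ => by positivity) (hsum_le R hR le_rfl) 2
  -- the weighted part: group by the gcd
  have hW₁ : ∑ x ∈ S, A x ≤ C₁ ^ 2 * C₂ * R * L ^ (2 * κ₁ + κ₂) := by
    set T := (Icc 1 R).sigma fun g => ((Icc 1 (R / g)).sigma fun t₁ => Icc 1 t₁) with hT
    set G : (Σ _ : ℕ, Σ _ : ℕ, ℕ) → ℝ := fun y =>
      (σ 0 y.1 : ℝ) ^ (2 * r) * ((σ 0 y.2.1 : ℝ) ^ r / y.2.1 * (σ 0 y.2.2 : ℝ) ^ r) with hG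
    set φ : (Σ _ : ℕ, ℕ) → (Σ _ : ℕ, Σ _ : ℕ, ℕ) := fun x =>
      ⟨Nat.gcd x.1 x.2, x.1 / Nat.gcd x.1 x.2, x.2 / Nat.gcd x.1 x.2⟩ with hφ
    have hG0 : ∀ y ∈ T, 0 ≤ G y := fun y _ => by positivity
    -- membership facts for `x ∈ S`
    have hxS : ∀ x ∈ S, 1 ≤ x.1 ∧ x.1 ≤ R ∧ 1 ≤ x.2 ∧ x.2 ≤ x.1 := by
      rintro ⟨s₁, s₂⟩ hx
      rw [hS, mem_sigma, mem_Icc, mem_Icc] at hx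
      exact ⟨hx.1.1, hx.1.2, hx.2.1, hx.2.2⟩
    have hmaps : ∀ x ∈ S, φ x ∈ T := by
      intro x hx
      obtain ⟨h1, h2, h3, h4⟩ := hxS x hx
      set g := Nat.gcd x.1 x.2 with hg
      have hg0 : 0 < g := Nat.gcd_pos_of_pos_left _ (by omega)
      have hg1 : g ≤ x.1 := Nat.gcd_le_left _ (by omega)
      have hg2 : g ≤ x.2 := Nat.gcd_le_right _ (by omega)
      have hgR : g ≤ R := hg1.trans h2
      simp only [hT, hφ, mem_sigma, mem_Icc, ← hg]
      refine ⟨⟨hg0, hgR⟩, ⟨(Nat.one_le_div_iff hg0).mpr hg1, Nat.div_le_div_right h2⟩,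
        (Nat.one_le_div_iff hg0).mpr hg2, Nat.div_le_div_right h4⟩
    have hinj : Set.InjOn φ S := by
      intro x hx x' hx' hxx'
      obtain ⟨h1, -, h3, -⟩ := hxS x hx
      obtain ⟨h1', -, h3', -⟩ := hxS x' hx'
      simp only [hφ, Sigma.mk.injEq, heq_eq_eq] at hxx'
      obtain ⟨hg, ht₁, ht₂⟩ := hxx'
      have e1 : x.1 = x'.1 := by
        rw [← Nat.div_mul_cancel (Nat.gcd_dvd_left x.1 x.2), ht₁, hg,
          Nat.div_mul_cancel (Nat.gcd_dvd_left x'.1 x'.2)]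
      have e2 : x.2 = x'.2 := by
        rw [← Nat.div_mul_cancel (Nat.gcd_dvd_right x.1 x.2), ht₂, hg,
          Nat.div_mul_cancel (Nat.gcd_dvd_right x'.1 x'.2)]
      exact Sigma.ext e1 (heq_of_eq e2)
    have hFG : ∀ x ∈ S, A x ≤ G (φ x) := by
      intro x hx
      obtain ⟨h1, h2, h3, h4⟩ := hxS x hx
      set g := Nat.gcd x.1 x.2 with hg
      set t₁ := x.1 / g with ht₁
      set t₂ := x.2 / g with ht₂
      have hg0 : 0 < g := Nat.gcd_pos_of_pos_left _ (by omega)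
      have hx1 : x.1 = g * t₁ := (Nat.mul_div_cancel' (Nat.gcd_dvd_left x.1 x.2)).symm
      have hx2 : x.2 = g * t₂ := (Nat.mul_div_cancel' (Nat.gcd_dvd_right x.1 x.2)).symm
      have ht₁0 : 0 < t₁ := by
        rcases Nat.eq_zero_or_pos t₁ with h0 | h0
        · rw [h0, mul_zero] at hx1; omega
        · exact h0
      have hτ1 : (σ 0 x.1 : ℝ) ≤ (σ 0 g : ℝ) * σ 0 t₁ := by
        rw [hx1]; exact_mod_cast sigma_zero_mul_le g t₁
      have hτ2 : (σ 0 x.2 : ℝ) ≤ (σ 0 g : ℝ) * σ 0 t₂ := by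
        rw [hx2]; exact_mod_cast sigma_zero_mul_le g t₂
      have hw : (g : ℝ) / x.1 = 1 / t₁ := by
        rw [hx1]; push_cast
        rw [div_mul_eq_div_div, div_self (by exact_mod_cast hg0.ne')]
      simp only [hA, hG, hφ, ← hg, ← ht₁, ← ht₂]
      rw [hw]
      have hg0' : (0 : ℝ) ≤ σ 0 g := by positivity
      calc 1 / (t₁ : ℝ) * (σ 0 x.1 : ℝ) ^ r * (σ 0 x.2 : ℝ) ^ r
          ≤ 1 / (t₁ : ℝ) * ((σ 0 g : ℝ) * σ 0 t₁) ^ r * ((σ 0 g : ℝ) * σ 0 t₂) ^ r := by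
            have e1 := pow_le_pow_left₀ (by positivity) hτ1 r
            have e2 := pow_le_pow_left₀ (by positivity) hτ2 r
            exact mul_le_mul (mul_le_mul_of_nonneg_left e1 (by positivity)) e2 (by positivity)
              (by positivity)
        _ = (σ 0 g : ℝ) ^ (2 * r) * ((σ 0 t₁ : ℝ) ^ r / t₁ * (σ 0 t₂ : ℝ) ^ r) := by
            rw [mul_pow, mul_pow, pow_mul, sq]; ring
    -- the sum over `T`
    have hT_sum : ∑ y ∈ T, G y ≤ C₁ ^ 2 * C₂ * R * L ^ (2 * κ₁ + κ₂) := by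
      rw [hT, sum_sigma]
      simp only [hG]
      have hinner : ∀ g ∈ Icc 1 R,
          ∑ y ∈ (Icc 1 (R / g)).sigma (fun t₁ => Icc 1 t₁),
            (σ 0 g : ℝ) ^ (2 * r) * ((σ 0 y.1 : ℝ) ^ r / y.1 * (σ 0 y.2 : ℝ) ^ r) ≤
          (σ 0 g : ℝ) ^ (2 * r) / g * (C₁ ^ 2 * R * L ^ (2 * κ₁)) := by
        intro g hg
        rw [mem_Icc] at hg
        have hg0 : (0 : ℝ) < g := by exact_mod_cast hg.1
        have hRg1 : 1 ≤ R / g := (Nat.one_le_div_iff hg.1).mpr hg.2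
        rw [← mul_sum, sum_sigma]
        -- inner double sum ≤ C₁² (R/g) L^{2κ₁}
        have step : ∑ t₁ ∈ Icc 1 (R / g), ∑ t₂ ∈ Icc 1 t₁,
            (σ 0 t₁ : ℝ) ^ r / t₁ * (σ 0 t₂ : ℝ) ^ r ≤ C₁ ^ 2 * (R / g) * L ^ (2 * κ₁) := by
          calc ∑ t₁ ∈ Icc 1 (R / g), ∑ t₂ ∈ Icc 1 t₁, (σ 0 t₁ : ℝ) ^ r / t₁ * (σ 0 t₂ : ℝ) ^ r
              = ∑ t₁ ∈ Icc 1 (R / g), (σ 0 t₁ : ℝ) ^ r / t₁ * ∑ t₂ ∈ Icc 1 t₁, (σ 0 t₂ : ℝ) ^ r := by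
                refine sum_congr rfl fun t₁ _ => ?_; rw [mul_sum]
            _ ≤ ∑ t₁ ∈ Icc 1 (R / g), (σ 0 t₁ : ℝ) ^ r / t₁ * (C₁ * t₁ * L ^ κ₁) := by
                refine sum_le_sum fun t₁ ht₁ => ?_
                rw [mem_Icc] at ht₁
                have ht₁R : t₁ ≤ R := ht₁.2.trans (Nat.div_le_self R g)
                exact mul_le_mul_of_nonneg_left (hsum_le t₁ ht₁.1 ht₁R) (by positivity)
            _ = C₁ * L ^ κ₁ * ∑ t₁ ∈ Icc 1 (R / g), (σ 0 t₁ : ℝ) ^ r := by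
                rw [mul_sum]
                refine sum_congr rfl fun t₁ ht₁ => ?_
                rw [mem_Icc] at ht₁
                have : (t₁ : ℝ) ≠ 0 := by exact_mod_cast (show t₁ ≠ 0 by omega)
                field_simp
            _ ≤ C₁ * L ^ κ₁ * (C₁ * (R / g : ℕ) * L ^ κ₁) :=
                mul_le_mul_of_nonneg_left (hsum_le _ hRg1 (Nat.div_le_self R g)) (by positivity)
            _ ≤ C₁ * L ^ κ₁ * (C₁ * ((R : ℝ) / g) * L ^ κ₁) := by
                gcongr
                exact Nat.cast_div_le
            _ = C₁ ^ 2 * (R / g) * L ^ (2 * κ₁) := by rw [pow_mul, sq, sq]; ring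
        calc (σ 0 g : ℝ) ^ (2 * r) * ∑ t₁ ∈ Icc 1 (R / g), ∑ t₂ ∈ Icc 1 t₁,
              (σ 0 t₁ : ℝ) ^ r / t₁ * (σ 0 t₂ : ℝ) ^ r
            ≤ (σ 0 g : ℝ) ^ (2 * r) * (C₁ ^ 2 * (R / g) * L ^ (2 * κ₁)) :=
              mul_le_mul_of_nonneg_left step (by positivity)
          _ = (σ 0 g : ℝ) ^ (2 * r) / g * (C₁ ^ 2 * R * L ^ (2 * κ₁)) := by
              field_simp
      calc ∑ g ∈ Icc 1 R, ∑ y ∈ (Icc 1 (R / g)).sigma (fun t₁ => Icc 1 t₁),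
            (σ 0 g : ℝ) ^ (2 * r) * ((σ 0 y.1 : ℝ) ^ r / y.1 * (σ 0 y.2 : ℝ) ^ r)
          ≤ ∑ g ∈ Icc 1 R, (σ 0 g : ℝ) ^ (2 * r) / g * (C₁ ^ 2 * R * L ^ (2 * κ₁)) :=
            sum_le_sum hinner
        _ = (C₁ ^ 2 * R * L ^ (2 * κ₁)) * ∑ g ∈ Icc 1 R, (σ 0 g : ℝ) ^ (2 * r) / g := by
            rw [mul_sum]; refine sum_congr rfl fun g _ => ?_; ring
        _ ≤ (C₁ ^ 2 * R * L ^ (2 * κ₁)) * (C₂ * L ^ κ₂) :=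
            mul_le_mul_of_nonneg_left (h₂ R hR) (by positivity)
        _ = C₁ ^ 2 * C₂ * R * L ^ (2 * κ₁ + κ₂) := by rw [pow_add]; ring
    calc ∑ x ∈ S, A x ≤ ∑ x ∈ S, G (φ x) := sum_le_sum hFG
      _ = ∑ y ∈ S.image φ, G y := (sum_image hinj).symm
      _ ≤ ∑ y ∈ T, G y :=
          sum_le_sum_of_subset_of_nonneg (image_subset_iff.mpr hmaps) fun y hy _ => hG0 y hy
      _ ≤ _ := hT_sum
  -- assemble
  rw [hLHS]
  have hR0 : (0 : ℝ) ≤ R := by positivity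
  have h2R : (2 * (R : ℝ) + 1) ≤ 3 * R := by linarith
  have hLpow : L ^ (2 * κ₁) ≤ L ^ (2 * κ₁ + κ₂) := pow_le_pow_right₀ hL (by omega)
  calc (2 * (R : ℝ) + 1) * ∑ x ∈ S, A x + ∑ x ∈ S, B x
      ≤ 3 * R * (C₁ ^ 2 * C₂ * R * L ^ (2 * κ₁ + κ₂)) + (C₁ * R * L ^ κ₁) ^ 2 := by
        have hA0 : 0 ≤ ∑ x ∈ S, A x := sum_nonneg fun x _ => by positivity
        exact add_le_add (mul_le_mul h2R hW₁ hA0 (by positivity)) hW₂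
    _ = 3 * C₁ ^ 2 * C₂ * (R : ℝ) ^ 2 * L ^ (2 * κ₁ + κ₂) + C₁ ^ 2 * (R : ℝ) ^ 2 * L ^ (2 * κ₁) := by
        rw [mul_pow, mul_pow, ← pow_mul, mul_comm κ₁ 2]; ring
    _ ≤ 3 * C₁ ^ 2 * C₂ * (R : ℝ) ^ 2 * L ^ (2 * κ₁ + κ₂) + C₁ ^ 2 * (R : ℝ) ^ 2 * L ^ (2 * κ₁ + κ₂) := by
        gcongr
    _ = (3 * C₁ ^ 2 * C₂ + C₁ ^ 2) * (R : ℝ) ^ 2 * L ^ (2 * κ₁ + κ₂) := by ring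

end Literature.NumberTheory.Sieve.FriedlanderIwaniecPrimes
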